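import Summits.CriticalPhenomena.CardyFormulaZ2.Theorems.CardyComplexConeSLESixFamiliesGiveCardyDefs
import Mathlib.MeasureTheory.Measure.Portmanteau

/-!
# drefute gen-6 — candidate proof of STUB C `stub_touchLimsup : TouchLimsup`
(crux `SLESixFamiliesGiveCardy`, stmt-CriticalPhenomena-9654, line `collar-touch-sandwich`)

Closed-set portmanteau along the mesh filter `𝓝[>] 0`, written against the LANDED definitions
module `Theorems/CardyComplexConeSLESixFamiliesGiveCardyDefs.lean` (p74855).  Positive result:
NOT a refutation — attached as item evidence / crux workfile for the lead prover to land under its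
own name (the theorem here is deliberately NOT called `stub_touchLimsup`, to avoid an FQN clash
with the lead's landing).

Proof: `hitsBefore K ∅ = (rangeSubset Kᶜ)ᶜ` is closed (`isClosed_hitsBefore_empty_right`);
the pre-Wiener measure is a probability measure BECAUSE `TendstoLaw` holds for the constant test
function `1` (no import of the Kolmogorov-extension discharge needed); package the eventually
a.e.-measurable push-forwards as `ProbabilityMeasure`s (junk value = the limit law at the
non-measurable meshes, harmless under `Tendsto.congr'`), get weak convergence from
`ProbabilityMeasure.tendsto_iff_forall_integral_tendsto`, then
`ProbabilityMeasure.limsup_measure_closed_le_of_tendsto` and `eventually_lt_of_limsup_lt`.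
-/

noncomputable section

open Set Filter Topology Metric MeasureTheory
open scoped NNReal ENNReal
open Literature.Probability Literature.Probability.RandomPlanarGeometry
  Literature.Probability.LatticeModels Literature.Probability.Percolation

namespace Summit.CriticalPhenomena.CardyFormulaZ2.Cruxes.SLESixFamiliesGiveCardy.CollarTouchSandwich

namespace DrefuteG6

/-- If `X δ → Γ` in law (`TendstoLaw`, bounded continuous test functions) from probability spaces,
the target measure is a probability measure (test the constant function `1`). [folklore] -/
theorem isProbabilityMeasure_of_tendstoLaw {Ωδ : ℝ → Type*} [∀ δ, MeasurableSpace (Ωδ δ)]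
    {Ω' : Type*} [MeasurableSpace Ω'] {Y : Type*} [TopologicalSpace Y]
    {X : ∀ δ, Ωδ δ → Y} {P : ∀ δ, Measure (Ωδ δ)} [∀ δ, IsProbabilityMeasure (P δ)]
    {Z : Ω' → Y} {P' : Measure Ω'} (h : TendstoLaw X P Z P') : IsProbabilityMeasure P' := by
  have h1 := h (BoundedContinuousFunction.const Y (1 : ℝ))
  simp only [BoundedContinuousFunction.const_apply, integral_const, smul_eq_mul, mul_one,
    probReal_univ] at h1
  have h2 : P'.real univ = 1 := (tendsto_nhds_unique tendsto_const_nhds h1).symm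
  refine ⟨?_⟩
  rw [measureReal_def, ENNReal.toReal_eq_one_iff] at h2
  exact h2

/-- **STUB C** (`TouchLimsup`), proved. [folklore] -/
theorem touchLimsup_proof : TouchLimsup := by
  intro X Γ hΓ hX hlaw K hK E hE ε hε
  classical
  -- notation
  set P : Measure (BondConfig (Site 2)) := bondPercolation (zdGraph 2) Percolation.half with hP
  set μW : Measure (ℝ≥0 → ℝ) := Process.preWienerMeasure with hμW
  haveI hPprob : IsProbabilityMeasure P := by rw [hP]; infer_instance
  haveI hWprob : IsProbabilityMeasure μW := isProbabilityMeasure_of_tendstoLaw hlaw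
  -- the closed target event
  set F : Set (CurveClass ℂ) := CurveClass.hitsBefore K (∅ : Set ℂ) with hF
  have hFc : IsClosed F := CurveClass.isClosed_hitsBefore_empty_right hK
  have hFm : MeasurableSet F := hFc.measurableSet
  have hpre : ∀ c : CurveClass ℂ, c ∈ F ↔ (c.range ∩ K).Nonempty := by
    intro c
    rw [hF, CurveClass.hitsBefore_empty_right, mem_compl_iff, CurveClass.mem_rangeSubset,
      Set.not_subset]
    constructor
    · rintro ⟨z, hz, hzK⟩
      exact ⟨z, hz, not_notMem.1 hzK⟩
    · rintro ⟨z, hz, hzK⟩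
      exact ⟨z, hz, not_notMem.2 hzK⟩
  -- the limit law and the (eventually honest) push-forward laws, as probability measures
  set μ : ProbabilityMeasure (CurveClass ℂ) := ⟨μW.map Γ, Measure.isProbabilityMeasure_map hΓ⟩
    with hμ
  set μs : ℝ → ProbabilityMeasure (CurveClass ℂ) := fun δ =>
    if h : AEMeasurable (X δ) P then ⟨P.map (X δ), Measure.isProbabilityMeasure_map h⟩ else μ
    with hμs
  have hμs_eq : ∀ δ, AEMeasurable (X δ) P → ((μs δ : ProbabilityMeasure (CurveClass ℂ)) :
      Measure (CurveClass ℂ)) = P.map (X δ) := by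
    intro δ h
    simp only [hμs, dif_pos h, ProbabilityMeasure.coe_mk]
  -- weak convergence of the packaged laws
  have hlim : Tendsto μs (𝓝[>] (0 : ℝ)) (𝓝 μ) := by
    rw [ProbabilityMeasure.tendsto_iff_forall_integral_tendsto]
    intro f
    have hf := hlaw f
    have hμint : ∫ c, f c ∂(μ : Measure (CurveClass ℂ)) = ∫ ω, f (Γ ω) ∂μW := by
      simp only [hμ, ProbabilityMeasure.coe_mk]
      exact integral_map hΓ f.continuous.aestronglyMeasurable
    rw [hμint]
    refine hf.congr' ?_
    filter_upwards [hX] with δ hδ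
    rw [hμs_eq δ hδ, integral_map hδ f.continuous.aestronglyMeasurable]
  -- closed-set portmanteau: limsup ≤ μ F, hence eventually < μ F + ε
  have hlimsup := ProbabilityMeasure.limsup_measure_closed_le_of_tendsto hlim hFc
  have hlt : (μ : Measure (CurveClass ℂ)) F < (μ : Measure (CurveClass ℂ)) F + ENNReal.ofReal ε :=
    ENNReal.lt_add_right (measure_ne_top _ _) (by simpa using hε)
  have hev : ∀ᶠ δ in 𝓝[>] (0 : ℝ),
      ((μs δ : ProbabilityMeasure (CurveClass ℂ)) : Measure (CurveClass ℂ)) F <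
        (μ : Measure (CurveClass ℂ)) F + ENNReal.ofReal ε :=
    eventually_lt_of_limsup_lt (hlimsup.trans_lt hlt)
  -- conclude
  filter_upwards [hev, hX, hE] with δ hδ hXδ hEδ
  have hsub : E δ ⊆ X δ ⁻¹' F := fun ω hω => (hpre _).2 (hEδ hω)
  have h1 : P.real (E δ) ≤ P.real (X δ ⁻¹' F) := measureReal_mono hsub
  have h2 : P.real (X δ ⁻¹' F) = (P.map (X δ)).real F := by
    rw [measureReal_def, measureReal_def, Measure.map_apply_of_aemeasurable hXδ hFm]
  have h3 : (P.map (X δ)).real F < (μW.map Γ).real F + ε := by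
    rw [← hμs_eq δ hXδ] at *
    have hμF : (μ : Measure (CurveClass ℂ)) F = (μW.map Γ) F := by simp only [hμ, ProbabilityMeasure.coe_mk]
    rw [measureReal_def, measureReal_def, ← hμF]
    have hfin : (μ : Measure (CurveClass ℂ)) F + ENNReal.ofReal ε ≠ ∞ :=
      ENNReal.add_ne_top.2 ⟨measure_ne_top _ _, ENNReal.ofReal_ne_top⟩
    have := (ENNReal.toReal_lt_toReal (measure_ne_top _ _) hfin).2 hδ
    rwa [ENNReal.toReal_add (measure_ne_top _ _) ENNReal.ofReal_ne_top,
      ENNReal.toReal_ofReal hε.le] at this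
  linarith
end DrefuteG6

end Summit.CriticalPhenomena.CardyFormulaZ2.Cruxes.SLESixFamiliesGiveCardy.CollarTouchSandwich
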